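import Literature.NumberTheory.LFunctions.RayClassSieveConst
import HarnessLib

/-!
# The mean value constant for a congruence class group `mod 𝔪` with the sieve parameter, every degree

Topic `Literature/NumberTheory/LFunctions`, namespace `Literature.NumberTheory.LFunctions.AbelianDensity`.
Everything here is PROVED (theorems only; no definitions, no named facts).

The ray-class analogue of the tree's `ClassGroupLogFreeSieveConstAllDegrees.card_mul_meanValueConst_le_param`
(the case `𝔪 = 1`; wide kernel `A = (n+2)T'` as in `ClassGroupLogFreeSavingAllDegrees`): the packaged log-free saving of the mean value theorem
`RayClassMeanValue.congruence_meanValue_primes_le` for a congruence class group of order `h` modulo `𝔪`, in the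
form consumed by the middle range of Bombieri's Théorème 14.
* `card_mul_rayMeanValueConst_wide_le_param (n)` — there are `D, C_M > 0` depending only on `n` such that for
  `n_K ≤ n`, `P ≥ 2` with `|d_K| ≤ P`, `N𝔪 ≤ P`, `h ≤ P`, `κ_K ≥ 1/P`, `1 ≤ T' ≤ 2P`, `a₀ L_x ≥ D log P`,
  `x^{a₀}/2 ≤ N_X ≤ x^{a₀}` (`x = e^{L_x}`) and `z = ⌊N_X^{1/(2n+4)}⌋`: `1 ≤ z ≤ N_X`, `z ≤ x^{a₀/2}`, `P ≤ z` and
  `h · M_𝔪((n+2)T', n_K+3, z, N_X) ≤ C_M/L_x` (wide kernel `A = (n+2)T'`, every degree).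

## References
* [ThornerZaman2017] J. Thorner, A. Zaman, Algebra Number Theory 11 (2017), Theorem 4.1, (4-4).
* [Weiss1983] A. Weiss, J. reine angew. Math. 338 (1983) 56–94, §1 (the log-free large sieve).
-/

noncomputable section

open Complex Finset IsDedekindDomain NumberField Filter
open scoped Topology

namespace Literature.NumberTheory.LFunctions.AbelianDensity

open Literature.NumberTheory.LFunctions.WeissKernel Literature.NumberTheory.LFunctions.NumberField
  Literature.NumberTheory.Sieve.Squarefree Literature.NumberTheory.LFunctions.LogFreeDensity
open scoped nonZeroDivisors _root_.NumberField Classical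

set_option maxHeartbeats 800000 in
/-- **The mean value constant `mod 𝔪` with the sieve parameter `z = ⌊N_X^{1/(2n+4)}⌋`, every degree**: there are
`D, C_M > 0` depending only on `n` such that for `n_K ≤ n`, a congruence class group of order `h ≥ 1` modulo
`𝔪 ≠ 0`, `P ≥ 2` with `|d_K| ≤ P`, `N𝔪 ≤ P`, `h ≤ P`, `κ_K ≥ 1/P`, `1 ≤ T' ≤ 2P`, `a₀ L_x ≥ D log P`, and
`x^{a₀}/2 ≤ N_X ≤ x^{a₀}` (`x = e^{L_x}`, `a₀ = expoB`), the integer `z = ⌊N_X^{1/(2n+4)}⌋` satisfies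
`1 ≤ z ≤ N_X`, `z ≤ x^{a₀/2}`, `P ≤ z` (so that `z`-sifted ideals are prime to `𝔪` when `N𝔪 ≤ P`), and `h · M_𝔪((n+2)T', n_K+3, z, N_X) ≤ C_M/L_x` (`card_mul_rayMeanValueConst_le` at the
balancing point `u₀`, with `log z − u₀ − (m+1)/(2T') ≥ a₀ L_x/(4n+8)` and the secondary term `≤ 1/L_x`).
[cite: ThornerZaman2017, Theorem 4.1] -/
theorem card_mul_rayMeanValueConst_wide_le_param (n : ℕ) :
    ∃ D C_M : ℝ, 0 < D ∧ 0 < C_M ∧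
      ∀ (K : Type*) [Field K] [NumberField K], Module.finrank ℚ K ≤ n →
      ∀ (𝔪 : Ideal (𝓞 K)) (h𝔪 : 𝔪 ≠ ⊥) (h : ℕ), 0 < h →
      ∀ (P T' Lx : ℝ), 2 ≤ P → ((NumberField.discr K).natAbs : ℝ) ≤ P →
        ((Ideal.absNorm 𝔪 : ℕ) : ℝ) ≤ P → (h : ℝ) ≤ P → P⁻¹ ≤ dedekindZeta_residue K →
        1 ≤ T' → T' ≤ 2 * P → D * Real.log P ≤ expoB * Lx →
        ∀ (NX z : ℕ), (NX : ℝ) ≤ Real.exp Lx ^ expoB → Real.exp Lx ^ expoB / 2 ≤ NX →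
          z = ⌊(NX : ℝ) ^ (1 / (2 * (n : ℝ) + 4))⌋₊ →
          1 ≤ z ∧ z ≤ NX ∧ (z : ℝ) ≤ Real.exp Lx ^ (expoB / 2) ∧ P ≤ (z : ℝ) ∧
          (h : ℝ) * rayMeanValueConst K 𝔪 h𝔪 h (((n : ℝ) + 2) * T') (Module.finrank ℚ K + 3) z NX ≤ C_M / Lx := by
  set a : ℝ := expoB with ha
  have hapos : 0 < a := expoB_pos
  have ha1 : a ≤ 1 / 2 := expoB_le_half
  have hn0 : (0 : ℝ) ≤ n := Nat.cast_nonneg n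
  set E : ℝ := 2 * (n : ℝ) + 4 with hE
  have hE0 : 0 < E := by positivity
  have hE4 : 4 ≤ E := by rw [hE]; linarith
  set W : ℝ := 40 * ((n : ℝ) + 1) ^ 2 + 2 * n ^ 2 + 17 * n + 60 with hW
  have hW0 : 0 < W := by positivity
  set D : ℝ := 2 * E * W + 2200 with hD
  have hDpos : 0 < D := by positivity
  set C_M : ℝ := 16 * ((n : ℝ) + 2) * ((n : ℝ) + 4) * Real.exp n / a + 1 with hC_M
  have hC_Mpos : 0 < C_M := by positivity
  refine ⟨D, C_M, hDpos, hC_Mpos, fun K _ _ hnK 𝔪 h𝔪 h hhpos P T' Lx hP hd hN𝔪 hh hκ hT'1 hT'2 hDLx NX z hNXle hNXhalf hzdef => ?_⟩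
  /- ── sizes ── -/
  have hPpos : 0 < P := by linarith
  have hP1 : 1 ≤ P := by linarith
  set Lp : ℝ := Real.log P with hLp
  have hLp2 : Real.log 2 ≤ Lp := Real.log_le_log (by norm_num) hP
  have hlog2 : (0.69 : ℝ) ≤ Real.log 2 := by have := Real.log_two_gt_d9; linarith
  have hlog2' : Real.log 2 ≤ 0.7 := by have := Real.log_two_lt_d9; linarith
  have hLppos : 0 < Lp := by linarith
  have hLp69 : (0.69 : ℝ) ≤ Lp := by linarith
  set t : ℝ := a * Lx with ht
  have htE : 2 * E * W * Lp ≤ t := by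
    have : 2 * E * W * Lp ≤ D * Lp := mul_le_mul_of_nonneg_right (by rw [hD]; linarith) hLppos.le
    linarith
  have hq : W * Lp ≤ t / (2 * E) := by
    rw [le_div_iff₀ (by positivity)]; linarith
  have ht2200 : 2200 * Lp ≤ t := by
    have hD' : (2200 : ℝ) ≤ D := by
      rw [hD]; have : 0 ≤ 2 * E * W := by positivity
      linarith
    have : 2200 * Lp ≤ D * Lp := mul_le_mul_of_nonneg_right hD' hLppos.le
    linarith
  have ht1500 : 1500 ≤ t := by
    have := mul_le_mul_of_nonneg_left hLp69 (show (0 : ℝ) ≤ 2200 by norm_num)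
    linarith
  have htpos : 0 < t := by linarith
  have hLxpos : 0 < Lx := by
    have h : a * 0 < a * Lx := by rw [mul_zero]; linarith
    exact lt_of_mul_lt_mul_left h hapos.le
  /- ── `x^{a}`, `NX` ── -/
  have hxa : Real.exp Lx ^ a = Real.exp t := by rw [ht, ← Real.exp_mul, mul_comm]
  have hxpos : 0 < Real.exp Lx := Real.exp_pos _
  have hxa512 : (512 : ℝ) ≤ Real.exp Lx ^ a := by
    rw [hxa]; linarith [Real.add_one_le_exp t]
  have hNX256 : (256 : ℝ) ≤ NX := by linarith
  have hNX1 : 1 ≤ NX := by exact_mod_cast (show (1 : ℝ) ≤ NX by linarith)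
  have hNXpos : (0 : ℝ) < NX := by linarith
  have hlogNX : t - 1 ≤ Real.log NX := by
    have h1 : Real.log (Real.exp Lx ^ a / 2) ≤ Real.log NX := Real.log_le_log (by positivity) hNXhalf
    rw [Real.log_div (by positivity) two_ne_zero, hxa, Real.log_exp] at h1
    linarith
  /- ── `w = NX^{1/E}`, `z = ⌊w⌋` ── -/
  set w : ℝ := (NX : ℝ) ^ (1 / E) with hw
  have hw0 : 0 < w := Real.rpow_pos_of_pos hNXpos _
  have hwE : w ^ (2 * n + 4) = NX := by
    rw [hw, ← Real.rpow_natCast, ← Real.rpow_mul hNXpos.le]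
    have hcast : ((2 * n + 4 : ℕ) : ℝ) = E := by rw [hE]; push_cast; ring
    rw [hcast, one_div, inv_mul_cancel₀ hE0.ne', Real.rpow_one]
  have hlogw : Real.log w = Real.log NX / E := by
    rw [hw, Real.log_rpow hNXpos]; ring
  have hlogw_low : (t - 1) / E ≤ Real.log w := by
    rw [hlogw]; exact div_le_div_of_nonneg_right hlogNX hE0.le
  have hE_inv : 1 / E ≤ 1 / 4 := one_div_le_one_div_of_le (by norm_num) hE4
  have htE' : t / E = 2 * (t / (2 * E)) := by field_simp
  have hlogw_low' : 2 * (t / (2 * E)) - 1 / E ≤ Real.log w := by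
    have h1 : (t - 1) / E = t / E - 1 / E := by rw [sub_div]
    rw [h1, htE'] at hlogw_low
    exact hlogw_low
  have hn2 : (0 : ℝ) ≤ (n : ℝ) ^ 2 := by positivity
  have hn12 : (0 : ℝ) ≤ ((n : ℝ) + 1) ^ 2 := by positivity
  have h60 : 60 * Lp ≤ W * Lp :=
    mul_le_mul_of_nonneg_right (by rw [hW]; linarith) hLppos.le
  have hlogw1 : 1 ≤ Real.log w := by linarith
  have hw2 : 2 ≤ w := by
    have : Real.log 2 ≤ Real.log w := by linarith
    exact (Real.log_le_log_iff (by norm_num) hw0).1 this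
  have hzdef' : z = ⌊w⌋₊ := hzdef
  have hzle : (z : ℝ) ≤ w := by rw [hzdef']; exact Nat.floor_le hw0.le
  have hzgt : w < z + 1 := by rw [hzdef']; exact Nat.lt_floor_add_one _
  have hz1 : 1 ≤ z := by rw [hzdef']; exact Nat.le_floor (by simp only [Nat.cast_one]; linarith)
  have hz1r : (1 : ℝ) ≤ z := by exact_mod_cast hz1
  have hzpos : (0 : ℝ) < z := by linarith
  have hzhalfw : w / 2 ≤ z := by linarith
  have hlogz : 2 * (t / (2 * E)) - 1 / E - 0.7 ≤ Real.log z := by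
    have h1 : Real.log (w / 2) ≤ Real.log z := Real.log_le_log (by positivity) hzhalfw
    rw [Real.log_div hw0.ne' two_ne_zero] at h1
    linarith
  have hPz : P ≤ (z : ℝ) := by
    have h1 : Lp ≤ Real.log z := by
      have : (119 : ℝ) * 0.69 ≤ 119 * Lp := by nlinarith
      linarith [hlogz, hq, h60, hE_inv]
    calc P = Real.exp Lp := (Real.exp_log hPpos).symm
      _ ≤ Real.exp (Real.log z) := Real.exp_le_exp.mpr h1
      _ = z := Real.exp_log hzpos
  have hzE : (z : ℝ) ^ (2 * n + 4) ≤ NX := by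
    calc (z : ℝ) ^ (2 * n + 4) ≤ w ^ (2 * n + 4) := pow_le_pow_left₀ (Nat.cast_nonneg z) hzle _
      _ = NX := hwE
  have hw_le_NX : w ≤ NX := by
    rw [hw]
    calc (NX : ℝ) ^ (1 / E) ≤ (NX : ℝ) ^ (1 : ℝ) :=
          Real.rpow_le_rpow_of_exponent_le (by exact_mod_cast hNX1) (by linarith)
      _ = NX := Real.rpow_one _
  have hzNX : z ≤ NX := by exact_mod_cast hzle.trans hw_le_NX
  have hzhalf : (z : ℝ) ≤ Real.exp Lx ^ (a / 2) := by
    calc (z : ℝ) ≤ w := hzle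
      _ = (NX : ℝ) ^ (1 / E) := hw
      _ ≤ (NX : ℝ) ^ ((1 : ℝ) / 2) := Real.rpow_le_rpow_of_exponent_le (by exact_mod_cast hNX1) (by linarith)
      _ ≤ (Real.exp Lx ^ a) ^ ((1 : ℝ) / 2) := Real.rpow_le_rpow (Nat.cast_nonneg _) hNXle (by norm_num)
      _ = Real.exp Lx ^ (a / 2) := by rw [← Real.rpow_mul hxpos.le]; ring_nf
  /- ── kernel parameters `A = (n+2)T'`, `m = n_K + 3`, balancing point ── -/
  set nK : ℕ := Module.finrank ℚ K with hnK'
  set m : ℕ := nK + 3 with hm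
  have hm3 : Module.finrank ℚ K + 3 ≤ m := le_rfl
  have hnKn : (nK : ℝ) ≤ n := by exact_mod_cast hnK
  have hnK0 : (0 : ℝ) ≤ nK := Nat.cast_nonneg _
  have hmcast : (m : ℝ) = nK + 3 := by rw [hm]; push_cast; ring
  set A : ℝ := ((n : ℝ) + 2) * T' with hAdef
  have hA0 : 0 < A := by positivity
  have hmA : ((m : ℝ) + 1) / A ≤ 2 := by
    rw [div_le_iff₀ hA0, hmcast, hAdef]
    have : 0 ≤ ((n : ℝ) + 2) * (T' - 1) := mul_nonneg (by positivity) (by linarith)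
    linarith
  obtain ⟨u₀, hu₀def⟩ : ∃ u : ℝ, u = rayBalancePoint K 𝔪 A m := ⟨_, rfl⟩
  have hu₀ : rayErr K 𝔪 A m u₀ ≤ coprimeResidue K 𝔪 h𝔪 / 2 := by
    rw [hu₀def]; exact rayErr_rayBalancePoint_le h𝔪 A m
  have hu₀le : u₀ ≤ 40 * ((n : ℝ) + 1) ^ 2 * Lp := by
    rw [hu₀def]; exact rayBalancePoint_wide_le_of_le h𝔪 hnK hP hT'1 hT'2 hd hN𝔪 hκ
  -- the saving denominator
  have hW1 : (2 * (n : ℝ) ^ 2 + 17 * n + 60) * 0.69 ≤ (2 * (n : ℝ) ^ 2 + 17 * n + 60) * Lp :=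
    mul_le_mul_of_nonneg_left hLp69 (by positivity)
  have hqW : W * Lp = 40 * ((n : ℝ) + 1) ^ 2 * Lp + (2 * (n : ℝ) ^ 2 + 17 * n + 60) * Lp := by rw [hW]; ring
  have hden : t / (2 * E) + 1 ≤ Real.log z - u₀ - ((m : ℝ) + 1) / A := by
    linarith [hq, hqW, hW1, hlogz, hu₀le, hmA, hE_inv, hn0, hn2]
  have hden1 : 1 ≤ Real.log z - u₀ - ((m : ℝ) + 1) / A := by
    have : 0 ≤ t / (2 * E) := by positivity
    linarith
  have hdenpos : 0 < Real.log z - u₀ - ((m : ℝ) + 1) / A := by linarith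
  /- ── `h_K M ≤ C_M/Lx` ── -/
  have h1 := card_mul_rayMeanValueConst_le h𝔪 hA0 hm3 hz1r (NX : ℝ) hu₀ hden1 h hhpos
  have h2 := raySecondary_wide_le_of_le (𝔪 := 𝔪) hnK hP hT'1 hT'2 hd hN𝔪 h𝔪 hh hzpos.le hzE (by exact_mod_cast hNX1)
  rw [← hw] at h2
  -- main term
  have hmain : 4 * ((m : ℝ) + 1) * Real.exp nK / (Real.log z - u₀ - ((m : ℝ) + 1) / A) ≤
      16 * ((n : ℝ) + 2) * ((n : ℝ) + 4) * Real.exp n / a / Lx := by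
    have hnum : 4 * ((m : ℝ) + 1) * Real.exp nK ≤ 4 * ((n : ℝ) + 4) * Real.exp n := by
      have he : Real.exp (nK : ℝ) ≤ Real.exp n := Real.exp_le_exp.mpr hnKn
      have h0 : 0 ≤ Real.exp (nK : ℝ) := (Real.exp_pos _).le
      rw [hmcast]
      have h5 : ((nK : ℝ) + 3 + 1) * Real.exp (nK : ℝ) ≤ ((n : ℝ) + 4) * Real.exp n :=
        mul_le_mul (by linarith) he h0 (by positivity)
      linarith
    have hden' : t / (2 * E) ≤ Real.log z - u₀ - ((m : ℝ) + 1) / A := by linarith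
    have h3 : 4 * ((m : ℝ) + 1) * Real.exp nK / (Real.log z - u₀ - ((m : ℝ) + 1) / A) ≤
        4 * ((n : ℝ) + 4) * Real.exp n / (t / (2 * E)) := div_le_div₀ (by positivity) hnum (by positivity) hden'
    refine h3.trans (le_of_eq ?_)
    rw [ht, hE]
    field_simp [hapos.ne', hLxpos.ne']
    ring
  -- secondary term: `w ≥ e^{2n²+17n+30} P^{2n+12} Lx`
  have hsec : Real.exp (2 * n ^ 2 + 17 * n + 30) * P ^ (2 * n + 12) * w⁻¹ ≤ 1 / Lx := by
    -- `log Lx = log t + log 480 + 14`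
    have hlogLx : Real.log Lx = Real.log t + Real.log 480 + 14 := by
      have : Real.log t = Real.log a + Real.log Lx := by rw [ht, Real.log_mul hapos.ne' hLxpos.ne']
      rw [this, ha, expoB, one_div, Real.log_inv, Real.log_mul (by norm_num) (Real.exp_pos _).ne', Real.log_exp]
      ring
    have h480 : Real.log 480 ≤ 6.5 := log_480_le
    -- `log t ≤ t/(2E)` as `t ≥ 16 E²`
    have ht16 : 4 * (2 * E) ^ 2 ≤ t := by
      have h1 : 16 * E ≤ W * 0.69 * 2 := by rw [hE, hW]; linarith
      have h2 : W * 0.69 ≤ W * Lp := mul_le_mul_of_nonneg_left hLp69 hW0.le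
      have h3 : E * (16 * E) ≤ E * (W * 0.69 * 2) := mul_le_mul_of_nonneg_left h1 hE0.le
      have h4 : 2 * E * (W * 0.69) ≤ 2 * E * (W * Lp) := mul_le_mul_of_nonneg_left h2 (by positivity)
      linarith [h3, h4, htE]
    have hlogt : Real.log t ≤ t / (2 * E) := log_le_div_of_sq_le (by positivity) ht16
    have hW2 : (40 * ((n : ℝ) + 1) ^ 2 + 2 * n ^ 2 + 15 * n + 48) * 0.69 ≤
        (40 * ((n : ℝ) + 1) ^ 2 + 2 * n ^ 2 + 15 * n + 48) * Lp := mul_le_mul_of_nonneg_left hLp69 (by positivity)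
    have hqW' : W * Lp = (2 * (n : ℝ) + 12) * Lp + (40 * ((n : ℝ) + 1) ^ 2 + 2 * n ^ 2 + 15 * n + 48) * Lp := by
      rw [hW]; ring
    have hwlow : Real.exp (2 * n ^ 2 + 17 * n + 30) * P ^ (2 * n + 12) * Lx ≤ w := by
      have h3 : Real.log (Real.exp (2 * n ^ 2 + 17 * n + 30) * P ^ (2 * n + 12) * Lx) ≤ Real.log w := by
        rw [Real.log_mul (by positivity) hLxpos.ne', Real.log_mul (by positivity) (by positivity), Real.log_exp,
          Real.log_pow, hlogLx]
        push_cast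
        linarith [hlogw_low', hlogt, hq, hqW', hW2, hE_inv, h480, hn0, hn2]
      exact (Real.log_le_log_iff (by positivity) hw0).mp h3
    have hinv : w⁻¹ ≤ (Real.exp (2 * n ^ 2 + 17 * n + 30) * P ^ (2 * n + 12) * Lx)⁻¹ := inv_anti₀ (by positivity) hwlow
    calc Real.exp (2 * n ^ 2 + 17 * n + 30) * P ^ (2 * n + 12) * w⁻¹
        ≤ Real.exp (2 * n ^ 2 + 17 * n + 30) * P ^ (2 * n + 12) *
            (Real.exp (2 * n ^ 2 + 17 * n + 30) * P ^ (2 * n + 12) * Lx)⁻¹ :=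
          mul_le_mul_of_nonneg_left hinv (by positivity)
      _ = 1 / Lx := by field_simp
  have hM : (h : ℝ) * rayMeanValueConst K 𝔪 h𝔪 h A m z NX ≤ C_M / Lx := by
    calc (h : ℝ) * rayMeanValueConst K 𝔪 h𝔪 h A m z NX
        ≤ _ := h1
      _ ≤ 16 * ((n : ℝ) + 2) * ((n : ℝ) + 4) * Real.exp n / a / Lx + 1 / Lx := add_le_add hmain (h2.trans hsec)
      _ = C_M / Lx := by rw [hC_M, add_div]
  exact ⟨hz1, hzNX, hzhalf, hPz, hM⟩

end Literature.NumberTheory.LFunctions.AbelianDensity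

end
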